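import Literature.NumberTheory.IwasawaTheory.CyclotomicTwoTotallyRamifiedNoSqrtTwo
import Literature.NumberTheory.IwasawaTheory.ZpExtensionNormKernelOnePrime
import Literature.NumberTheory.EllipticCurves.DivisionFieldTwoSupersingularUniquePrime
import HarnessLib

/-!
# The cyclotomic `ℤ₂`-tower of `ℚ(W[2])`, `W` good supersingular at `2`: Fukuda index `0`, and Iwasawa's kernel theorem
# `ker(N : Cl(M_n) → Cl(M)) = I_{Gal(M_n/M)}·Cl(M_n)` at every level — UNCONDITIONALLY (Serre Prop. 12 + Washington §13)

Topic `Literature/NumberTheory/IwasawaTheory` (namespace = path).  THEOREMS ONLY (no definition, no named fact, no `sorry`), written by the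
prover seat `bsd-wall-rtt-p4-w2` g20 (cell `bsd-wall`; `--supports` stmt-BirchSwinnertonDyer-21438, line `nonsquare-descent`, stub S2 input
«`A_k ≅ X/ω_k X`» on the habitat tower; closes nothing; BSD is proved for no curve here).  Assembles the tree theorems
`totallyRamifiedFrom_zero_of_forall_odd_ramificationIdx_of_not_four_dvd` (`CyclotomicTwoTotallyRamifiedNoSqrtTwo`),
`WeierstrassCurve.finrank_divisionField_two_eq_six_of_dvd_frobeniusTraceAt` / `ramificationIdx_divisionField_two_eq_three_…` /
`existsUnique_prime_divisionField_two_…` (`DivisionFieldTwoSupersingularUniquePrime`, Serre 1972 Prop. 12 at `p = 2`) and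
`ker_classGroupNorm_layer_eq_closure_of_totallyRamifiedFrom_zero` (`ZpExtensionNormKernelOnePrime`, Washington Prop. 13.22 / Lang Ch. 5 §4
Thm. 4.1 (iii) at finite level):

* **`totallyRamifiedFrom_zero_divisionField_two_of_dvd_frobeniusTraceAt`** — for `W/ℚ` good supersingular at `2`, every cyclotomic `ℤ₂`-extension
  of `M = ℚ(W[2])` has Fukuda index `0` (`[M:ℚ] = 6`, `e(𝔭|2) = 3` odd).
* **`ker_classGroupNorm_layer_divisionField_two_eq_closure`** — for every cyclotomic `ℤ₂`-tower `M_n` over `M = ℚ(W[2])` and every `n`: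
  `ker (N : Cl(M_n) → Cl(M)) = I_{Gal(M_n/M)} · Cl(M_n)`, i.e. `Cl(M)` is the coinvariant quotient of `Cl(M_n)` («`A_0 ≅ X/TX`» at level `n`).

References: [SerreInventiones1972] §1.11 Prop. 12 (c), (d); [Washington1997] §13.1 Lemma 13.3, §13.3 Lemma 13.15, Prop. 13.22; [Lang1990] Ch. 5 §4
Thm. 4.1 (iii) and Corollary; [Fukuda1994] p. 264.
-/

noncomputable section

open scoped NumberField Pointwise

namespace Literature.NumberTheory.IwasawaTheory

open Literature.NumberTheory.EllipticCurves Literature.NumberTheory.GaloisRepresentations Literature.NumberTheory.NumberFields Field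
  IsDedekindDomain NumberField

/-! ### The `2`-division field of a curve with good supersingular reduction at `2` -/

/-- **Fukuda's index is `0` on `ℚ(W[2])` for `W` good supersingular at `2`**: every cyclotomic `ℤ₂`-extension `κ` of `M = ℚ(W[2])` has
`TotallyRamifiedFrom κ 0` — `[M:ℚ] = 6` (`4 ∤ 6`) and the prime of `M` above `2` has `e = 3`, odd (Serre Prop. 12, tree
`DivisionFieldTwoSupersingularUniquePrime`). [cite: SerreInventiones1972, §1.11 Prop. 12 (c), (d)] [cite: Washington1997, §13.1 Lemma 13.3] -/
theorem totallyRamifiedFrom_zero_divisionField_two_of_dvd_frobeniusTraceAt (W : WeierstrassCurve ℚ) [W.IsElliptic]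
    (v : HeightOneSpectrum (𝓞 ℚ)) (hv : ((2 : ℕ) : 𝓞 ℚ) ∈ v.asIdeal) (hgood : W.HasGoodReductionAt v)
    (hss : (2 : ℤ) ∣ W.frobeniusTraceAt v) :
    haveI : NumberField (W.divisionField 2) := NumberField.mk
    ∀ κ : ZpExtension (W.divisionField 2) 2, κ.IsCyclotomic → TotallyRamifiedFrom κ 0 := by
  haveI : NumberField (W.divisionField 2) := NumberField.mk
  intro κ hκ
  refine totallyRamifiedFrom_zero_of_forall_odd_ramificationIdx_of_not_four_dvd ?_ κ hκ fun w hw => ?_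
  · rw [W.finrank_divisionField_two_eq_six_of_dvd_frobeniusTraceAt v hv hgood hss]; decide
  · rw [W.ramificationIdx_divisionField_two_eq_three_of_dvd_frobeniusTraceAt v hv hgood hss w hw]
    exact ⟨1, rfl⟩

/-- **IWASAWA'S KERNEL THEOREM ON THE HABITAT TOWER, UNCONDITIONALLY.**  For `W/ℚ` with good supersingular reduction at `2`, `M = ℚ(W[2])`, and
any cyclotomic `ℤ₂`-extension `κ` of `M` with layers `M_n = κ.layer n`: for every `n`, the kernel of the norm `Cl(M_n) → Cl(M)` is the subgroup
`I_{Gal(M_n/M)} · Cl(M_n)` generated by the classes `τ c / c` («`A(M) ≅ A(M_n)_{Gal}`», Washington Prop. 13.22 / Lang Ch. 5 §4 Thm. 4.1 (iii) at finite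
level) — all hypotheses (one prime above `2`, Fukuda index `0`) being theorems for this field.
[cite: Washington1997, §13.3 Lemma 13.15 and Prop. 13.22] [cite: Lang1990, Ch. 5 §4 Thm. 4.1 (iii) and Corollary] [cite: SerreInventiones1972, §1.11 Prop. 12] -/
theorem ker_classGroupNorm_layer_divisionField_two_eq_closure (W : WeierstrassCurve ℚ) [W.IsElliptic]
    (v : HeightOneSpectrum (𝓞 ℚ)) (hv : ((2 : ℕ) : 𝓞 ℚ) ∈ v.asIdeal) (hgood : W.HasGoodReductionAt v)
    (hss : (2 : ℤ) ∣ W.frobeniusTraceAt v) :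
    haveI : NumberField (W.divisionField 2) := NumberField.mk
    ∀ (κ : ZpExtension (W.divisionField 2) 2), κ.IsCyclotomic → ∀ (n : ℕ) [NumberField (κ.layer n)],
      (classGroupNorm (W.divisionField 2) (κ.layer n)).ker = Subgroup.closure {x : ClassGroup (𝓞 (κ.layer n)) |
        ∃ (τ : (κ.layer n) ≃ₐ[W.divisionField 2] (κ.layer n)) (d : ClassGroup (𝓞 (κ.layer n))),
          x = ClassGroup.mulEquiv (AmbiguousClass.intAut τ) d / d} := by
  haveI : NumberField (W.divisionField 2) := NumberField.mk
  intro κ hκ n _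
  haveI : Fact (Nat.Prime 2) := ⟨Nat.prime_two⟩
  obtain ⟨v₀, hv₀, huniq⟩ := W.existsUnique_prime_divisionField_two_of_dvd_frobeniusTraceAt v hv hgood hss
  exact ker_classGroupNorm_layer_eq_closure_of_totallyRamifiedFrom_zero κ n
    (totallyRamifiedFrom_zero_divisionField_two_of_dvd_frobeniusTraceAt W v hv hgood hss κ hκ) v₀ (fun w hw => huniq w hw)

end Literature.NumberTheory.IwasawaTheory

end
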